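import Literature.AnabelianGeometry.SemiGraphs.ApproximatorBridge
import Literature.AnabelianGeometry.SemiGraphs.ImmersionLiftUnique
import HarnessLib

/-!
# The compact completion of the levels, FAITHFUL form: joint injectivity of the extended data, and the
# intersection of the level kernels in `Q` under arithmetic cofinality ([SemiAnbd] Thm 5.4 (i) p. 66)

Mochizuki, *Semi-graphs of anabelioids*, Publ. RIMS **42** (2006), Thm 5.4 (i), manuscript p. 66 (l. 50:
"the proofs are entirely parallel to those of Theorem 3.7, Corollary 3.9"; Thm 3.7 (iii) p. 41 reads the
compact subgroup in the finite quotients of the tower) [cite: MochizukiSemiAnbd2006, Thm 5.4 (i) p.66].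

PROOF-ONLY sequel (seat abc-iut-w4-d029, T54-B piece (P-Q) second instalment, at abc-iut-w4-d059's
request 2026-08-26T05:20:31Z (Q1)/(Q2)) to `CompactCompletionOfLevels.lean` (`exists_compactCompletion`:
the compact Hausdorff group `Q` ⊇ dense image of `E` through which the finite-level actions `levelAct j`
and the augmentation `aug : E → Π_A` factor):

* `exists_compactCompletion_faithful` — the SAME package with one more exported clause, **(Q0)**: the
  extended data are JOINTLY FAITHFUL on `Q` — `q = 1` as soon as every `qAct j q = 1` and `augQ q = 1`
  (in the construction `Q ⊆ (∏_j Aut 𝔾_j) × Π_A`, so this is coordinatewise equality); with the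
  `ℕ`-indexed, universe-`u` corollary `exists_compactCompletion_faithful_nat`;
* `augQ_eq_one_of_forall_qAct_eq_one` — ABSTRACT (any package with dense `ιQ`, open kernels,
  `qAct j ∘ ιQ = levelAct j`, continuous `augQ` with `augQ ∘ ιQ = aug`): under ARITHMETIC COFINALITY of
  the tower in `Π_A` — "every neighbourhood of `1` in `Π_A` contains the image `aug (ker levelAct j)` of
  some level kernel" — an element of `Q` acting trivially on every level has trivial image in `Π_A`
  (density of `ιQ(E)` in the open kernels + regularity of `Π_A`);
* `iInf_ker_qAct_eq_bot` — **(Q2)**: hence, with (Q0), `⨅_j ker (qAct j) = ⊥` in `Q` under arithmetic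
  cofinality (abc-iut-w4-d059: FALSE for arithmetically lazy towers — the cofinality is the honest input);
* `qAct_levelTrans_of_denseRange` — density transfer: the `qAct j` commute with the level transitions
  as soon as the `levelAct j` do.

No definition; nothing here bears on [IUTchIII] Cor. 3.12.
-/

namespace Literature.AnabelianGeometry.SemiGraphs

open CategoryTheory Topology Filter

universe w v u

/-- **The compact completion package, faithful form** (piece (P-Q) with clause (Q0)): as
`exists_compactCompletion`, and moreover the extended level actions together with `augQ` are jointly
faithful on `Q`. [cite: MochizukiSemiAnbd2006, Thm 5.4 (i) p.66] -/
theorem exists_compactCompletion_faithful {E : Type u} [Group E] [TopologicalSpace E]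
    [IsTopologicalGroup E] {PA : Type u} [Group PA] [TopologicalSpace PA] [IsTopologicalGroup PA]
    [CompactSpace PA] [T2Space PA] (aug : E →* PA) (haug : Continuous aug) {J : Type v}
    (level : J → SemiGraph.{u}) [∀ j, Finite (level j).Vertex] [∀ j, Finite (level j).Branch]
    (levelAct : ∀ j, E →* Aut (level j)) (hker : ∀ j, IsOpen ((levelAct j).ker : Set E)) :
    ∃ (Q : Type (max u v)) (_ : Group Q) (_ : TopologicalSpace Q) (_ : IsTopologicalGroup Q)
      (_ : CompactSpace Q) (_ : T2Space Q) (ιQ : E →ₜ* Q) (qAct : ∀ j, Q →* Aut (level j))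
      (augQ : Q →ₜ* PA),
      DenseRange ιQ ∧ (∀ j, IsOpen ((qAct j).ker : Set Q)) ∧ (∀ j e, qAct j (ιQ e) = levelAct j e) ∧
        (∀ e, augQ (ιQ e) = aug e) ∧ ιQ.toMonoidHom.ker = (⨅ j, (levelAct j).ker) ⊓ aug.ker ∧
        ∀ q : Q, (∀ j, qAct j q = 1) → augQ q = 1 → q = 1 := by
  classical
  letI : ∀ j, TopologicalSpace (Aut (level j)) := fun _ => ⊥
  haveI : ∀ j, DiscreteTopology (Aut (level j)) := fun _ => ⟨rfl⟩
  haveI : ∀ j, Finite (Aut (level j)) := fun j => (level j).finite_aut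
  -- the ambient compact Hausdorff group and the diagonal homomorphism
  let Φ : E →* (∀ j, Aut (level j)) × PA := MonoidHom.prod (MonoidHom.pi levelAct) aug
  have hΦc : Continuous Φ := by
    refine Continuous.prodMk (continuous_pi fun j => ?_) haug
    exact continuous_of_isOpen_ker_of_discreteTopology (levelAct j) (hker j)
  let S : Subgroup ((∀ j, Aut (level j)) × PA) := Φ.range.topologicalClosure
  have hScpt : CompactSpace S :=
    isCompact_iff_compactSpace.mp (Subgroup.isClosed_topologicalClosure _).isCompact
  -- the corestriction `E → S`
  let f : E →* S := (Subgroup.inclusion (Subgroup.le_topologicalClosure Φ.range)).comp Φ.rangeRestrict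
  have hf : ∀ e, ((f e : S) : (∀ j, Aut (level j)) × PA) = Φ e := fun _ => rfl
  have hfc : Continuous f := continuous_induced_rng.2 (by
    have : (Subtype.val ∘ f) = Φ := funext hf
    rw [this]; exact hΦc)
  refine ⟨S, inferInstance, inferInstance, inferInstance, hScpt, inferInstance,
    { toMonoidHom := f, continuous_toFun := hfc },
    fun j => ((Pi.evalMonoidHom (fun j => Aut (level j)) j).comp (MonoidHom.fst _ _)).comp S.subtype,
    { toMonoidHom := (MonoidHom.snd _ _).comp S.subtype,
      continuous_toFun := continuous_snd.comp continuous_subtype_val },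
    ?_, fun j => ?_, fun _ _ => rfl, fun _ => rfl, ?_, ?_⟩
  · -- dense range: `S` is the closure of the range of `Φ`
    change Dense (Set.range f)
    rw [Subtype.dense_iff]
    intro x hx
    have hx' : x ∈ closure (Set.range Φ) := by
      simpa only [S, Subgroup.topologicalClosure_coe, MonoidHom.coe_range] using hx
    refine closure_mono ?_ hx'
    rintro _ ⟨e, rfl⟩
    exact ⟨f e, ⟨e, rfl⟩, hf e⟩
  · -- open kernels of the level actions on `Q`
    rw [MonoidHom.coe_ker]
    exact (isOpen_discrete _).preimage
      ((continuous_apply j).comp (continuous_fst.comp continuous_subtype_val))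
  · -- the kernel of `ιQ`
    ext e
    rw [MonoidHom.mem_ker, Subgroup.mem_inf, Subgroup.mem_iInf]
    simp only [MonoidHom.mem_ker]
    change f e = 1 ↔ _
    rw [← Subtype.coe_inj, hf, Subgroup.coe_one, Prod.ext_iff]
    simp only [Φ, MonoidHom.prod_apply, Prod.fst_one, Prod.snd_one, funext_iff, Pi.one_apply]
    exact Iff.rfl
  · -- (Q0) joint faithfulness: coordinatewise equality in `(∏_j Aut 𝔾_j) × Π_A`
    intro q hq hq'
    apply Subtype.ext
    refine Prod.ext (funext fun j => ?_) ?_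
    · exact hq j
    · exact hq'

/-- **The faithful compact completion package for an `ℕ`-indexed tower, in the universe of `E`.**
[cite: MochizukiSemiAnbd2006, Thm 5.4 (i) p.66] -/
theorem exists_compactCompletion_faithful_nat {E : Type u} [Group E] [TopologicalSpace E]
    [IsTopologicalGroup E] {PA : Type u} [Group PA] [TopologicalSpace PA] [IsTopologicalGroup PA]
    [CompactSpace PA] [T2Space PA] (aug : E →* PA) (haug : Continuous aug)
    (level : ℕ → SemiGraph.{u}) [∀ j, Finite (level j).Vertex] [∀ j, Finite (level j).Branch]
    (levelAct : ∀ j, E →* Aut (level j)) (hker : ∀ j, IsOpen ((levelAct j).ker : Set E)) :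
    ∃ (Q : Type u) (_ : Group Q) (_ : TopologicalSpace Q) (_ : IsTopologicalGroup Q)
      (_ : CompactSpace Q) (_ : T2Space Q) (ιQ : E →ₜ* Q) (qAct : ∀ j, Q →* Aut (level j))
      (augQ : Q →ₜ* PA),
      DenseRange ιQ ∧ (∀ j, IsOpen ((qAct j).ker : Set Q)) ∧ (∀ j e, qAct j (ιQ e) = levelAct j e) ∧
        (∀ e, augQ (ιQ e) = aug e) ∧ ιQ.toMonoidHom.ker = (⨅ j, (levelAct j).ker) ⊓ aug.ker ∧
        ∀ q : Q, (∀ j, qAct j q = 1) → augQ q = 1 → q = 1 :=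
  exists_compactCompletion_faithful aug haug level levelAct hker

/-- **Under arithmetic cofinality, an element of `Q` acting trivially on every level has trivial image
in `Π_A`** (abstract: any package with dense `ιQ`, open kernels, `qAct j ∘ ιQ = levelAct j`, continuous
`augQ` with `augQ ∘ ιQ = aug`).  Arithmetic cofinality = "every neighbourhood of `1 ∈ Π_A` contains
`aug (ker levelAct j)` for some `j`" (abc-iut-w4-d059: it FAILS for arithmetically lazy towers, where the
conclusion is false — it is the honest tower input).  Proof: `q` lies in the closure of `ιQ(E) ∩ ker qAct j`
= `ιQ (ker levelAct j)` for every `j`, so `augQ q` lies in the closure of every `aug (ker levelAct j)`, hence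
in every closed neighbourhood of `1`; `Π_A` is regular Hausdorff. [cite: MochizukiSemiAnbd2006, Thm 5.4 (i) p.66] -/
theorem augQ_eq_one_of_forall_qAct_eq_one {E : Type u} [Group E] [TopologicalSpace E]
    {PA : Type u} [Group PA] [TopologicalSpace PA] [IsTopologicalGroup PA] [T2Space PA]
    (aug : E →* PA) {Q : Type w} [Group Q] [TopologicalSpace Q] (ιQ : E →ₜ* Q) (hdense : DenseRange ιQ)
    {J : Type v} (level : J → SemiGraph.{u}) (levelAct : ∀ j, E →* Aut (level j))
    (qAct : ∀ j, Q →* Aut (level j)) (hqker : ∀ j, IsOpen ((qAct j).ker : Set Q))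
    (hqAct : ∀ j e, qAct j (ιQ e) = levelAct j e) (augQ : Q →ₜ* PA) (haugQ : ∀ e, augQ (ιQ e) = aug e)
    (hcof : ∀ U ∈ 𝓝 (1 : PA), ∃ j, ∀ e ∈ (levelAct j).ker, aug e ∈ U)
    (q : Q) (hq : ∀ j, qAct j q = 1) : augQ q = 1 := by
  -- `augQ q` lies in every closed neighbourhood of `1`
  have key : ∀ U ∈ 𝓝 (1 : PA), IsClosed U → augQ q ∈ U := by
    intro U hU hUc
    obtain ⟨j, hj⟩ := hcof U hU
    -- `q ∈ closure (ker qAct j ∩ range ιQ)`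
    have hq_cl : q ∈ closure (((qAct j).ker : Set Q) ∩ Set.range ιQ) :=
      hdense.open_subset_closure_inter (hqker j) (by simpa [MonoidHom.mem_ker] using hq j)
    -- push forward along the continuous `augQ`
    have himg : augQ q ∈ closure (augQ '' (((qAct j).ker : Set Q) ∩ Set.range ιQ)) :=
      (Set.mem_image_of_mem augQ hq_cl) |> fun h => image_closure_subset_closure_image
        augQ.continuous_toFun h
    refine closure_minimal ?_ hUc himg
    rintro _ ⟨x, ⟨hx, ⟨e, rfl⟩⟩, rfl⟩
    rw [haugQ]
    refine hj e ?_
    rw [MonoidHom.mem_ker, ← hqAct]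
    simpa [MonoidHom.mem_ker] using hx
  -- regularity: if `augQ q ≠ 1`, some closed neighbourhood of `1` misses it
  by_contra hne
  obtain ⟨t, ht, htc, hts⟩ := exists_mem_nhds_isClosed_subset (compl_singleton_mem_nhds (Ne.symm hne))
  exact hts (key t ht htc) rfl

/-- **(Q2) Under arithmetic cofinality the level kernels in `Q` intersect trivially** — for a FAITHFUL
package (clause (Q0) of `exists_compactCompletion_faithful`): an element acting trivially on every level
has trivial image in `Π_A` (`augQ_eq_one_of_forall_qAct_eq_one`), hence is trivial.  The cofinality
hypothesis is essential (arithmetically lazy towers violate the conclusion).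
[cite: MochizukiSemiAnbd2006, Thm 5.4 (i) p.66] -/
theorem iInf_ker_qAct_eq_bot {E : Type u} [Group E] [TopologicalSpace E]
    {PA : Type u} [Group PA] [TopologicalSpace PA] [IsTopologicalGroup PA] [T2Space PA]
    (aug : E →* PA) {Q : Type w} [Group Q] [TopologicalSpace Q] (ιQ : E →ₜ* Q) (hdense : DenseRange ιQ)
    {J : Type v} (level : J → SemiGraph.{u}) (levelAct : ∀ j, E →* Aut (level j))
    (qAct : ∀ j, Q →* Aut (level j)) (hqker : ∀ j, IsOpen ((qAct j).ker : Set Q))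
    (hqAct : ∀ j e, qAct j (ιQ e) = levelAct j e) (augQ : Q →ₜ* PA) (haugQ : ∀ e, augQ (ιQ e) = aug e)
    (hfaith : ∀ q : Q, (∀ j, qAct j q = 1) → augQ q = 1 → q = 1)
    (hcof : ∀ U ∈ 𝓝 (1 : PA), ∃ j, ∀ e ∈ (levelAct j).ker, aug e ∈ U) :
    (⨅ j, (qAct j).ker) = ⊥ := by
  rw [eq_bot_iff]
  intro q hq
  rw [Subgroup.mem_iInf] at hq
  have hq' : ∀ j, qAct j q = 1 := fun j => (MonoidHom.mem_ker).mp (hq j)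
  exact (Subgroup.mem_bot).mpr (hfaith q hq'
    (augQ_eq_one_of_forall_qAct_eq_one aug ιQ hdense level levelAct qAct hqker hqAct augQ haugQ hcof q hq'))

/-- **Density transfer: the extended level actions are compatible with the level transitions** (any
package with dense `ιQ`, open kernels of the `qAct j`, `qAct j ∘ ιQ = levelAct j`; `Q` need not be
compact): if the `levelAct j` commute with transition morphisms `levelTrans h : 𝔾_j ⟶ 𝔾_i`, so do the
`qAct j` — both sides are continuous maps `Q → (𝔾_j ⟶ 𝔾_i)` to a discrete space agreeing on the dense
image of `E` ([SemiAnbd] Thm 3.7 (iii) p. 41: compatible systems of the finite levels).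
[cite: MochizukiSemiAnbd2006, Thm 3.7 (iii) p.41] -/
theorem qAct_levelTrans_of_denseRange {E : Type u} [Group E] [TopologicalSpace E]
    {Q : Type w} [Group Q] [TopologicalSpace Q] [IsTopologicalGroup Q] (ιQ : E →ₜ* Q)
    (hdense : DenseRange ιQ) {J : Type v} [Preorder J] (level : J → SemiGraph.{u})
    (levelAct : ∀ j, E →* Aut (level j)) (qAct : ∀ j, Q →* Aut (level j))
    (hqker : ∀ j, IsOpen ((qAct j).ker : Set Q)) (hqAct : ∀ j e, qAct j (ιQ e) = levelAct j e)
    (levelTrans : ∀ ⦃i j : J⦄, i ≤ j → (level j ⟶ level i))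
    (levelTrans_act : ∀ ⦃i j : J⦄ (h : i ≤ j) (e : E),
      (levelAct j e).hom ≫ levelTrans h = levelTrans h ≫ (levelAct i e).hom)
    ⦃i j : J⦄ (h : i ≤ j) (q : Q) : (qAct j q).hom ≫ levelTrans h = levelTrans h ≫ (qAct i q).hom := by
  letI : ∀ j, TopologicalSpace (Aut (level j)) := fun _ => ⊥
  haveI : ∀ j, DiscreteTopology (Aut (level j)) := fun _ => ⟨rfl⟩
  letI : TopologicalSpace (level j ⟶ level i) := ⊥
  haveI : DiscreteTopology (level j ⟶ level i) := ⟨rfl⟩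
  have hc : ∀ j, Continuous (qAct j) := fun j =>
    continuous_of_isOpen_ker_of_discreteTopology (qAct j) (hqker j)
  have h₁ : Continuous fun q : Q => (qAct j q).hom ≫ levelTrans h :=
    (continuous_of_discreteTopology (f := fun a : Aut (level j) => a.hom ≫ levelTrans h)).comp (hc j)
  have h₂ : Continuous fun q : Q => levelTrans h ≫ (qAct i q).hom :=
    (continuous_of_discreteTopology (f := fun a : Aut (level i) => levelTrans h ≫ a.hom)).comp (hc i)
  refine congrFun (Continuous.ext_on hdense h₁ h₂ ?_) q
  rintro _ ⟨e, rfl⟩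
  simp only [hqAct, levelTrans_act]

/-- **Density transfer: the level kernels in `Q` are nested as soon as those in `E` are** (any package
with dense `ιQ`, open kernels of the `qAct j`, `qAct j ∘ ιQ = levelAct j`; `Q` need not be compact): if
`ker levelAct j ≤ ker levelAct i` then `ker qAct j ≤ ker qAct i` — the set
`(ker qAct j)ᶜ ∪ ker qAct i` is closed (open subgroups are closed) and contains the dense image of `E`
(the input `hanti` of abc-iut-w4-d059's `CompactOrbit.forall_apply_eq_iff_mem_map` at the `Q`-level, from
the `E`-level nesting of the tower). [cite: MochizukiSemiAnbd2006, Thm 3.7 (iii) p.41] -/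
theorem ker_qAct_le_of_denseRange {E : Type u} [Group E] [TopologicalSpace E]
    {Q : Type w} [Group Q] [TopologicalSpace Q] [IsTopologicalGroup Q] (ιQ : E →ₜ* Q)
    (hdense : DenseRange ιQ) {J : Type v} (level : J → SemiGraph.{u})
    (levelAct : ∀ j, E →* Aut (level j)) (qAct : ∀ j, Q →* Aut (level j))
    (hqker : ∀ j, IsOpen ((qAct j).ker : Set Q)) (hqAct : ∀ j e, qAct j (ιQ e) = levelAct j e)
    {i j : J} (hij : (levelAct j).ker ≤ (levelAct i).ker) : (qAct j).ker ≤ (qAct i).ker := by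
  intro q hq
  -- the closed set `(ker qAct j)ᶜ ∪ ker qAct i` contains the dense range of `ιQ`, hence everything
  have hA : IsClosed ((((qAct j).ker : Set Q))ᶜ ∪ ((qAct i).ker : Set Q)) :=
    (hqker j).isClosed_compl.union ((qAct i).ker.isClosed_of_isOpen (hqker i))
  have hsub : Set.range ιQ ⊆ (((qAct j).ker : Set Q))ᶜ ∪ ((qAct i).ker : Set Q) := by
    rintro _ ⟨e, rfl⟩
    by_cases he : ιQ e ∈ ((qAct j).ker : Set Q)
    · refine Or.inr ?_
      rw [SetLike.mem_coe, MonoidHom.mem_ker, hqAct] at he ⊢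
      exact hij he
    · exact Or.inl he
  have hall : q ∈ (((qAct j).ker : Set Q))ᶜ ∪ ((qAct i).ker : Set Q) := by
    have : closure (Set.range ιQ) ⊆ _ := hA.closure_subset_iff.mpr hsub
    rw [hdense.closure_eq] at this
    exact this (Set.mem_univ q)
  rcases hall with h | h
  · exact absurd hq h
  · exact h

end Literature.AnabelianGeometry.SemiGraphs
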